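import Summits.BirchSwinnertonDyer.BirchSwinnertonDyer.Theorems.AlignedTransportAtTwoMainConjectureOfRankZeroBSDAtTwoLayerValueBoundary
import HarnessLib

/-!
# Route `AlignedTransportAtTwo`, crux C2 `MainConjectureOfRankZeroBSDAtTwo` (stmt-BirchSwinnertonDyer-22298):
# THE LAYER-VALUE TRICHOTOMY — for `G ∈ ℤ_p⟦T⟧ ∖ {0}` with `p² ∣ G(0)` and `ζ` of order `pⁿ⁺¹` (`φ = φ(pⁿ⁺¹)`):
# `|G(ζ − 1)| > 1/p ⟺ μ = 0 ∧ λ < φ`, `= 1/p ⟺ μ = 0 ∧ λ = φ`, `< 1/p ⟺ μ ≥ 1 ∨ λ > φ`; the one-value certificate with the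
# EXTENDED RANGE `V ≤ φ` in integer and orbit-product (field-norm) form

HONEST FRAMING (cell `bsd-f1-sign2`, WIDTH-5 attached prover seat `bsd-line-att-p5` gen 50 on line `birth` of the lead
`bsd-line-att-p2`; `--supports` stmt-BirchSwinnertonDyer-22298, closes nothing; BSD is NOT proved by any of this; the crux C2, its
verdict «blocked-on `Rank1Residual.GreenbergMuConjectureIrreducible`» and every registered stub (P / T / Kμ / LimDoor / MuIneqʳ / PFμ⁺)
are untouched). THEOREMS ONLY — pure `p`-adic Λ-algebra; no `def`, no instance, no named fact, no `sorry`; nothing about any curve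
is asserted in this file. Sibling `…LayerValueBoundary` proved the boundary certificate `|G(ζ − 1)| = 1/p ∧ |G(0)| ≠ 1/p ⟹ μ(G) = 0 ∧
λ(G) = φ(pⁿ⁺¹)`, its converse and the super-boundary readings; here they are assembled:

* ★★★ `norm_tsum_eq_inv_iff` (**`|G(ζ − 1)| = 1/p ⟺ μ = 0 ∧ λ = φ`**, under `|G(0)| < 1/p`), ★★ `inv_lt_norm_tsum_iff` (the tree's open
  row both ways: `|G(ζ − 1)| > 1/p ⟺ μ = 0 ∧ λ < φ`), ★★★ `norm_tsum_lt_inv_iff` (**`|G(ζ − 1)| < 1/p ⟺ μ ≥ 1 ∨ λ > φ`**, under `|G(0)| < 1/p`).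
* ★★★ INTEGER FORM with the extended range: `|G(ζ − 1)|^φ = p^{−V}`, **`V ≤ φ`**, `|G(0)| ≠ 1/p ⟹ μ(G) = 0 ∧ λ(G) = V`
  (`mu_eq_zero_and_lam_eq_of_norm_tsum_pow_eq_of_le`; the tree's `mu_eq_zero_and_lam_eq_of_norm_tsum_pow_eq` is `V < φ`).
* ★★ ORBIT-PRODUCT FORM at the boundary (what an engine reads as the valuation of the FIELD NORM of one value of the layer; b2b ENGINE-T's
  row `V = e_n`, «undetermined» there): `∏_{ζ' of order pⁿ⁺¹} |G(ζ' − 1)| = p^{−φ}`, `|G(0)| ≠ 1/p ⟹ μ = 0 ∧ λ = φ`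
  (`mu_eq_zero_and_lam_eq_totient_of_prod_norm_tsum_eq`; the case `V < φ` is the tree's `mu_eq_zero_and_lam_eq_of_prod_norm_tsum_eq`).

References (ATTRIBUTION; proofs self-contained over the tree): L. Washington, GTM 83, §7.1–7.2 (Prop. 7.2, Thm. 7.3) [Washington1997];
R. Pollack, Duke Math. J. 118 (2003) Prop. 6.9–6.10 [Pollack2003]; tree `Iwasawa/LambdaInvariantValuation{,Layer,Twisted}.lean`.
-/

set_option linter.dupNamespace false
set_option autoImplicit false

noncomputable section

open scoped Classical

namespace Summit.BirchSwinnertonDyer.BirchSwinnertonDyer.Theorems.AlignedTransportAtTwoLayerValueTrichotomy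

open Polynomial Literature.NumberTheory.EllipticCurves
  Summit.BirchSwinnertonDyer.Rank1Residual.X1.MuLambda
  Summit.BirchSwinnertonDyer.Rank1Residual.Iwasawa
  Summit.BirchSwinnertonDyer.BirchSwinnertonDyer.Theorems.AlignedTransportAtTwoLayerValueBoundary

variable {p : ℕ} [hp : Fact p.Prime]

/-- ★★★ **THE TRICHOTOMY, boundary row**: under `|G(0)| < 1/p` (i.e. `p² ∣ G(0)`), **`|G(ζ − 1)| = 1/p ⟺ μ(G) = 0 ∧ λ(G) = φ(pⁿ⁺¹)`**.
[cite: Washington1997, §7.1–7.2 and Thm. 7.3] -/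
theorem norm_tsum_eq_inv_iff {G : IwasawaAlgebra p} (hG0 : G ≠ 0) {n : ℕ} {ζ : ℂ_[p]} (hζ : IsPrimitiveRoot ζ (p ^ (n + 1)))
    (h0 : ‖((algebraMap ℚ_[p] ℂ_[p]).comp (algebraMap ℤ_[p] ℚ_[p])) (PowerSeries.constantCoeff G)‖ < (p : ℝ)⁻¹) :
    ‖∑' k, ((algebraMap ℚ_[p] ℂ_[p]).comp (algebraMap ℤ_[p] ℚ_[p])) (PowerSeries.coeff k G) * (ζ - 1) ^ k‖ = (p : ℝ)⁻¹ ↔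
      mu G = 0 ∧ lam G = Nat.totient (p ^ (n + 1)) :=
  ⟨fun h ↦ mu_eq_zero_and_lam_eq_totient_of_norm_tsum_eq_inv hG0 hζ h h0.ne,
    fun h ↦ norm_tsum_eq_inv_of_lam_eq_totient hG0 h.1 hζ h.2 h0⟩

/-- ★★ **THE TRICHOTOMY, open row** (the tree's certificate both ways): `|G(ζ − 1)| > 1/p ⟺ μ(G) = 0 ∧ λ(G) < φ(pⁿ⁺¹)`.
[cite: Washington1997, §7.1–7.2 and Thm. 7.3] -/
theorem inv_lt_norm_tsum_iff {G : IwasawaAlgebra p} (hG0 : G ≠ 0) {n : ℕ} {ζ : ℂ_[p]} (hζ : IsPrimitiveRoot ζ (p ^ (n + 1))) :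
    (p : ℝ)⁻¹ < ‖∑' k, ((algebraMap ℚ_[p] ℂ_[p]).comp (algebraMap ℤ_[p] ℚ_[p])) (PowerSeries.coeff k G) * (ζ - 1) ^ k‖ ↔
      mu G = 0 ∧ lam G < Nat.totient (p ^ (n + 1)) := by
  constructor
  · intro h
    obtain ⟨hμ, hlam, -⟩ := mu_eq_zero_and_lam_lt_totient_of_lt_norm_tsum hG0 hζ h
    exact ⟨hμ, hlam⟩
  · rintro ⟨hμ, hlam⟩
    rw [norm_tsum_eq_of_lam_lt_totient hG0 hζ hlam, hμ, pow_zero, one_mul]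
    exact (inv_lt_norm_sub_one_pow_iff hζ _).mpr hlam

/-- ★★★ **THE TRICHOTOMY, lower row**: under `|G(0)| < 1/p`, **`|G(ζ − 1)| < 1/p ⟺ μ(G) ≥ 1 ∨ λ(G) > φ(pⁿ⁺¹)`**.
[cite: Washington1997, §7.1–7.2 and Thm. 7.3] -/
theorem norm_tsum_lt_inv_iff {G : IwasawaAlgebra p} (hG0 : G ≠ 0) {n : ℕ} {ζ : ℂ_[p]} (hζ : IsPrimitiveRoot ζ (p ^ (n + 1)))
    (h0 : ‖((algebraMap ℚ_[p] ℂ_[p]).comp (algebraMap ℤ_[p] ℚ_[p])) (PowerSeries.constantCoeff G)‖ < (p : ℝ)⁻¹) :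
    ‖∑' k, ((algebraMap ℚ_[p] ℂ_[p]).comp (algebraMap ℤ_[p] ℚ_[p])) (PowerSeries.coeff k G) * (ζ - 1) ^ k‖ < (p : ℝ)⁻¹ ↔
      1 ≤ mu G ∨ Nat.totient (p ^ (n + 1)) < lam G := by
  obtain ⟨-, hz⟩ := norm_sub_one_pos_and_lt_one hζ
  constructor
  · intro h
    rcases (norm_tsum_le_iff_one_le_mu_or_totient_le_lam hG0 hζ).mp h.le with h1 | h2
    · exact Or.inl h1
    · by_cases hμ : mu G = 0
      · refine Or.inr (lt_of_le_of_ne h2 fun heq ↦ ?_)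
        have := norm_tsum_eq_inv_of_lam_eq_totient hG0 hμ hζ heq.symm h0
        rw [this] at h
        exact lt_irrefl _ h
      · exact Or.inl (Nat.one_le_iff_ne_zero.mpr hμ)
  · rintro (h1 | h2)
    · exact norm_tsum_lt_inv_of_one_le_mu hG0 hz h1 h0.ne
    · by_cases hμ : mu G = 0
      · exact norm_tsum_lt_inv_of_totient_lt_lam hG0 hμ hζ h2 h0
      · exact norm_tsum_lt_inv_of_one_le_mu hG0 hz (Nat.one_le_iff_ne_zero.mpr hμ) h0.ne

/-- ★★★ **INTEGER FORM, extended range**: if `|G(ζ − 1)|^{φ(pⁿ⁺¹)} = p^{−V}` with **`V ≤ φ(pⁿ⁺¹)`** (`V` = the `p`-adic valuation of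
the layer's field norm) and `|G(0)| ≠ 1/p`, then `μ(G) = 0` and `λ(G) = V` (the tree's `mu_eq_zero_and_lam_eq_of_norm_tsum_pow_eq` is the
case `V < φ`). [cite: Washington1997, §7.1–7.2 and Thm. 7.3] [cite: Pollack2003, Prop. 6.9–6.10] -/
theorem mu_eq_zero_and_lam_eq_of_norm_tsum_pow_eq_of_le {G : IwasawaAlgebra p} (hG0 : G ≠ 0) {n : ℕ} {ζ : ℂ_[p]}
    (hζ : IsPrimitiveRoot ζ (p ^ (n + 1))) {V : ℕ} (hV : V ≤ Nat.totient (p ^ (n + 1)))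
    (h : ‖∑' k, ((algebraMap ℚ_[p] ℂ_[p]).comp (algebraMap ℤ_[p] ℚ_[p])) (PowerSeries.coeff k G) * (ζ - 1) ^ k‖ ^
        Nat.totient (p ^ (n + 1)) = ((p : ℝ)⁻¹) ^ V)
    (h0 : ‖((algebraMap ℚ_[p] ℂ_[p]).comp (algebraMap ℤ_[p] ℚ_[p])) (PowerSeries.constantCoeff G)‖ ≠ (p : ℝ)⁻¹) :
    mu G = 0 ∧ lam G = V := by
  rcases hV.lt_or_eq with hlt | heq
  · exact mu_eq_zero_and_lam_eq_of_norm_tsum_pow_eq hG0 hζ hlt h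
  · subst heq
    have hq0 : 0 ≤ (p : ℝ)⁻¹ := inv_nonneg.mpr (Nat.cast_nonneg _)
    have hφ : Nat.totient (p ^ (n + 1)) ≠ 0 := (Nat.totient_pos.mpr (pow_pos hp.out.pos _)).ne'
    have h1 : ‖∑' k, ((algebraMap ℚ_[p] ℂ_[p]).comp (algebraMap ℤ_[p] ℚ_[p])) (PowerSeries.coeff k G) * (ζ - 1) ^ k‖ =
        (p : ℝ)⁻¹ := (pow_left_inj₀ (norm_nonneg _) hq0 hφ).mp h
    exact mu_eq_zero_and_lam_eq_totient_of_norm_tsum_eq_inv hG0 hζ h1 h0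

/-- ★★ **ORBIT-PRODUCT FORM at the boundary** (what an engine reads as the valuation `V = φ(pⁿ⁺¹)` of the FIELD NORM of one value of
the layer): `∏_{ζ' of order pⁿ⁺¹} |G(ζ' − 1)| = p^{−φ(pⁿ⁺¹)}` and `|G(0)| ≠ 1/p` ⟹ `μ(G) = 0 ∧ λ(G) = φ(pⁿ⁺¹)` (outside the open regime
every factor is `≤ 1/p`, so equality of the product forces equality of each factor). The case `V < φ` is the tree's
`mu_eq_zero_and_lam_eq_of_prod_norm_tsum_eq` (`Iwasawa/LambdaInvariantValuationTwisted`). [cite: Washington1997, §7.1–7.2 and Thm. 7.3] -/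
theorem mu_eq_zero_and_lam_eq_totient_of_prod_norm_tsum_eq {G : IwasawaAlgebra p} (hG0 : G ≠ 0) {n : ℕ} {ζ₀ : ℂ_[p]}
    (hζ₀ : IsPrimitiveRoot ζ₀ (p ^ (n + 1)))
    (h : ∏ ζ ∈ primitiveRoots (p ^ (n + 1)) ℂ_[p],
      ‖∑' k, ((algebraMap ℚ_[p] ℂ_[p]).comp (algebraMap ℤ_[p] ℚ_[p])) (PowerSeries.coeff k G) * (ζ - 1) ^ k‖ =
        ((p : ℝ)⁻¹) ^ Nat.totient (p ^ (n + 1)))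
    (h0 : ‖((algebraMap ℚ_[p] ℂ_[p]).comp (algebraMap ℤ_[p] ℚ_[p])) (PowerSeries.constantCoeff G)‖ ≠ (p : ℝ)⁻¹) :
    mu G = 0 ∧ lam G = Nat.totient (p ^ (n + 1)) := by
  obtain ⟨hq0, hq1⟩ := inv_prime_pos_and_lt_one (p := p)
  have hpos : 0 < p ^ (n + 1) := pow_pos hp.out.pos _
  set F : ℂ_[p] → ℝ := fun ζ ↦
    ‖∑' k, ((algebraMap ℚ_[p] ℂ_[p]).comp (algebraMap ℤ_[p] ℚ_[p])) (PowerSeries.coeff k G) * (ζ - 1) ^ k‖ with hF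
  -- not the open regime: there the product would be `p^{−λ}` with `λ < φ`
  have hor : 1 ≤ mu G ∨ Nat.totient (p ^ (n + 1)) ≤ lam G := by
    by_contra hcon
    rw [not_or, not_le, not_le, Nat.lt_one_iff] at hcon
    obtain ⟨hμ, hlam⟩ := hcon
    have hconst : ∀ ζ ∈ primitiveRoots (p ^ (n + 1)) ℂ_[p], F ζ = ‖ζ₀ - 1‖ ^ lam G := by
      intro ζ hζ
      rw [mem_primitiveRoots hpos] at hζ
      simp only [hF]
      rw [norm_tsum_eq_of_lam_lt_totient hG0 hζ hlam, norm_sub_one_eq_of_isPrimitiveRoot hζ₀ hζ, hμ, pow_zero, one_mul]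
    have hprod : ∏ ζ ∈ primitiveRoots (p ^ (n + 1)) ℂ_[p], F ζ = ((p : ℝ)⁻¹) ^ lam G := by
      rw [Finset.prod_congr rfl hconst, Finset.prod_const, hζ₀.card_primitiveRoots, ← pow_mul, mul_comm, pow_mul,
        norm_sub_one_pow_totient_eq hζ₀]
    have heq : ((p : ℝ)⁻¹) ^ lam G = ((p : ℝ)⁻¹) ^ Nat.totient (p ^ (n + 1)) := hprod.symm.trans h
    exact absurd (pow_right_injective₀ hq0 hq1.ne heq) hlam.ne
  -- every factor is `≤ 1/p`; the product of `φ` such factors is `p^{−φ}` only if the factor at `ζ₀` is `1/p`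
  have hle : ∀ ζ ∈ primitiveRoots (p ^ (n + 1)) ℂ_[p], F ζ ≤ (p : ℝ)⁻¹ := by
    intro ζ hζ
    rw [mem_primitiveRoots hpos] at hζ
    exact (norm_tsum_le_iff_one_le_mu_or_totient_le_lam hG0 hζ).mpr hor
  have hmem₀ : ζ₀ ∈ primitiveRoots (p ^ (n + 1)) ℂ_[p] := (mem_primitiveRoots hpos).mpr hζ₀
  have hF₀ : F ζ₀ = (p : ℝ)⁻¹ := by
    by_contra hne
    have hlt₀ : F ζ₀ < (p : ℝ)⁻¹ := lt_of_le_of_ne (hle ζ₀ hmem₀) hne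
    -- then the product is `< p^{−φ}`
    have hlt : ∏ ζ ∈ primitiveRoots (p ^ (n + 1)) ℂ_[p], F ζ < ((p : ℝ)⁻¹) ^ Nat.totient (p ^ (n + 1)) := by
      rw [← hζ₀.card_primitiveRoots, ← Finset.prod_const, ← Finset.mul_prod_erase _ _ hmem₀,
        ← Finset.mul_prod_erase _ (fun _ ↦ (p : ℝ)⁻¹) hmem₀]
      have hrest : ∏ ζ ∈ (primitiveRoots (p ^ (n + 1)) ℂ_[p]).erase ζ₀, F ζ ≤
          ∏ ζ ∈ (primitiveRoots (p ^ (n + 1)) ℂ_[p]).erase ζ₀, (p : ℝ)⁻¹ :=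
        Finset.prod_le_prod (fun ζ _ ↦ by simp only [hF]; exact norm_nonneg _)
          fun ζ hζ ↦ hle ζ (Finset.mem_of_mem_erase hζ)
      have hrest0 : 0 ≤ ∏ ζ ∈ (primitiveRoots (p ^ (n + 1)) ℂ_[p]).erase ζ₀, F ζ :=
        Finset.prod_nonneg fun ζ _ ↦ by simp only [hF]; exact norm_nonneg _
      have hrestpos : 0 < ∏ ζ ∈ (primitiveRoots (p ^ (n + 1)) ℂ_[p]).erase ζ₀, (p : ℝ)⁻¹ :=
        Finset.prod_pos fun _ _ ↦ hq0
      calc F ζ₀ * ∏ ζ ∈ (primitiveRoots (p ^ (n + 1)) ℂ_[p]).erase ζ₀, F ζ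
          ≤ F ζ₀ * ∏ ζ ∈ (primitiveRoots (p ^ (n + 1)) ℂ_[p]).erase ζ₀, (p : ℝ)⁻¹ :=
            mul_le_mul_of_nonneg_left hrest (by simp only [hF]; exact norm_nonneg _)
        _ < (p : ℝ)⁻¹ * ∏ ζ ∈ (primitiveRoots (p ^ (n + 1)) ℂ_[p]).erase ζ₀, (p : ℝ)⁻¹ :=
            mul_lt_mul_of_pos_right hlt₀ hrestpos
    rw [h] at hlt
    exact lt_irrefl _ hlt
  exact mu_eq_zero_and_lam_eq_totient_of_norm_tsum_eq_inv hG0 hζ₀ hF₀ h0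


end Summit.BirchSwinnertonDyer.BirchSwinnertonDyer.Theorems.AlignedTransportAtTwoLayerValueTrichotomy

end
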